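import Summits.HodgeConjecture.HodgeConjecture.Theses.BoundaryReadout
import Summits.HodgeConjecture.HodgeConjecture.Theses.QbarEnvelope
import Summits.HodgeConjecture.HodgeConjecture.Theorems.PadicSemiregularLiftHodgeBeyondAnchorsDiagonalPullback
import Literature.AlgebraicGeometry.HodgeTheory.AlgebraicClassesPullback
import HarnessLib

/-!
# `PullbackAlgebraic` (stmt-HodgeConjecture-1071) — negative lane: identity and ceiling

Standing disprover's load-bearing record for the crux `PullbackAlgebraic`
(`Summit.HodgeConjecture.HodgeConjecture.Theses.BoundaryReadout.PullbackAlgebraic`, verbatim also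
`…Theses.QbarEnvelope.PullbackAlgebraic`): for every `ℂ`-morphism `ι : X ⟶ W` of smooth projective
complex varieties and every `p`, `ι^*(Nᵖ H²ᵖ(W(ℂ); ℂ)) ⊆ Nᵖ H²ᵖ(X(ℂ); ℂ)` on the coniveau carrier
`algebraicClasses`.

* `pullbackAlgebraic_iff_qbarEnvelope` — the two route decls are the same statement;
* `pullbackAlgebraic_iff_fulton1998` — the crux is, up to binder order, the named fact
  `fulton1998_map_mem_algebraicClasses` (Fulton 1998, Cor. 19.2 (b); Voisin II, Prop. 9.21 (i));
* `not_hodgeConjecture_of_not_pullbackAlgebraic` — **the ceiling**: any refutation of the crux refutes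
  the summit as typed, because `HodgeConjecture ⟹ fulton1998_map_mem_algebraicClasses` is a theorem of
  the tree (`HodgeBeyondAnchors.fulton1998_map_mem_algebraicClasses_of_hodgeConjecture`: `Nᵖ H²ᵖ(W)` is
  spanned by rational `(p,p)` classes and `ι^*` preserves rationality and Hodge type). No unconditional
  `¬ PullbackAlgebraic` can therefore be landed short of `¬ HodgeConjecture`.

The full adversarial record (carrier audit, the paper counterexample showing that smoothness of the
TARGET is the load-bearing hypothesis while every hypothesis on the source is idle, the degenerate
regimes, and the stub-by-stub reading of line `normal_cone`) is the crux workfile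
`Cruxes/PullbackAlgebraic/Disproof.lean`.

References: W. Fulton, *Intersection Theory*, 2nd ed. (1998), §19.2 Cor. 19.2 (b); C. Voisin, *Hodge
Theory and Complex Algebraic Geometry I* (2002), Prop. 11.20, §7.3.2; *II* (2003), Prop. 9.21 (i).
-/

noncomputable section

-- `Summit.HodgeConjecture.HodgeConjecture.…` is the mandated namespace (single-conjunct summit).
set_option linter.dupNamespace false

namespace Summit.HodgeConjecture.HodgeConjecture.Theorems.PullbackAlgebraic.Negative

open CategoryTheory
open Literature.AlgebraicGeometry.HodgeTheory
open Summit.HodgeConjecture.HodgeConjecture.Theses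

/-- The two route decls wanting the shared item stmt-HodgeConjecture-1071 are the same statement.
[folklore] -/
theorem pullbackAlgebraic_iff_qbarEnvelope :
    BoundaryReadout.PullbackAlgebraic ↔ QbarEnvelope.PullbackAlgebraic :=
  ⟨fun h _ _ hX _ _ hW ι p c' hc' ↦ h hX hW ι p c' hc',
    fun h _ _ hX _ _ hW ι p c' hc' ↦ h hX hW ι p c' hc'⟩

/-- **The crux is the named fact `fulton1998_map_mem_algebraicClasses`, up to binder order** (Fulton
1998, Cor. 19.2 (b): "the mapping `cl : A^*X → H^*X` is … contravariant for morphisms of non-singular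
varieties"). [cite: Fulton1998, §19.2 Cor. 19.2 (b)] [cite: VoisinHodgeII2003, Prop. 9.21 (i)] -/
theorem pullbackAlgebraic_iff_fulton1998 :
    BoundaryReadout.PullbackAlgebraic ↔ fulton1998_map_mem_algebraicClasses :=
  ⟨fun h _ _ _ _ j hY hX p β hβ ↦ h hX hY j p β hβ, fun h _ _ hX _ _ hW ι p c' hc' ↦ h ι hW hX p c' hc'⟩

/-- **Ceiling: a refutation of the crux is a refutation of the Hodge conjecture as typed.**
`HodgeConjecture ⟹ fulton1998_map_mem_algebraicClasses` is the tree theorem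
`HodgeBeyondAnchors.fulton1998_map_mem_algebraicClasses_of_hodgeConjecture` (pull back to a source all of
whose rational `(p,p)`-classes are algebraic); contrapose through `pullbackAlgebraic_iff_fulton1998`.
[cite: VoisinHodgeI2002, Prop. 11.20 and §7.3.2] [cite: Fulton1998, §19.2 Cor. 19.2 (b)] -/
theorem not_hodgeConjecture_of_not_pullbackAlgebraic (h : ¬ BoundaryReadout.PullbackAlgebraic) :
    ¬ _root_.HodgeConjecture :=
  fun hc ↦ h (pullbackAlgebraic_iff_fulton1998.2
    (Theorems.HodgeBeyondAnchors.fulton1998_map_mem_algebraicClasses_of_hodgeConjecture hc))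

/-- The same ceiling for the `QbarEnvelope` copy of the decl. [cite: Fulton1998, §19.2 Cor. 19.2 (b)] -/
theorem not_hodgeConjecture_of_not_pullbackAlgebraic_qbarEnvelope
    (h : ¬ QbarEnvelope.PullbackAlgebraic) : ¬ _root_.HodgeConjecture :=
  not_hodgeConjecture_of_not_pullbackAlgebraic fun hP ↦ h (pullbackAlgebraic_iff_qbarEnvelope.1 hP)

end Summit.HodgeConjecture.HodgeConjecture.Theorems.PullbackAlgebraic.Negative

end
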